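import Literature.Probability.Percolation.TriUQuadScale
import Literature.Probability.Percolation.TriQuadGoodEvent
import HarnessLib

/-!
# The good event of a scale, trimmed for independence across scales

Topic `Literature/Probability/Percolation`; family `crit-perc`, statement **crit-perc.S16**
(`Literature.Probability.Percolation.triTheta_exponent`). For the multiscale summation of Kesten's
"inner separation" bound of the half-plane two-arm probability at two radii (P. Nolin, EJP 13
(2008), §4.4–§4.5 [arXiv 0711.4948: §4.4–§4.5]; H. Kesten, CMP 109 (1987), Lemma 4) we need, at
each scale `s`, an event `Gsc` with three properties: (i) it contains the good event
`TriQuad.Good` of `TriQuadGoodEvent.lean` (so its failure probability is small, `real_not_good_le`);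
(ii) together with the two arms it implies the frame event `Zev ∩ {ω ∈ Aev ω}` of
`TriUQuadScale.lean`; (iii) it is **determined by the shell** of the scale — the quad `U_{s,2s}`
and the part of the inner half-box within `A` of the inner arc — so that the events of the scales
`s_j = 3^j k₀` are independent. `Gsc` is `Good` with the fence frames demanded only at stages
carrying a canonical crossing (at the other stages the tip is a junk point and the fence frame
would sit deep inside the inner half-box).

* `armEv_mono_inner` — the two-arm event of `U_{k,N}` implies that of `U_{s,N}`, `k ≤ s`.
* `Gsc`, `good_subset_gsc`, `armEv_inter_gsc_subset` — (i) and (ii).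
* `shell`, `determinedBy_gsc`, `determinedBy_armEv` — (iii).

## References

* P. Nolin, Near-critical percolation in two dimensions, *Electron. J. Probab.* 13 (2008), §4.4,
  §4.5 [arXiv 0711.4948] [Nolin2008].
* H. Kesten, Scaling relations for 2D-percolation, *Comm. Math. Phys.* 109 (1987), Lemma 4
  [KestenScalingCMP1987].

## Mathlib / tree

Tree: `TriQuad.Good` (`TriQuadGoodEvent.lean`), `Zev`, `Aev`, `armEv`, `mem_zev_aev`, `sel_selStage`,
`uQ` (`TriUQuadScale.lean`), `TriQuad.numStages_congr`, `protO_congr`, `canonSet_congr`,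
`openStop_congr` (`TriQuadCongr.lean`), `determinedBy_triFrameAt`, `mem_triSqAnnulusFinset`,
`PathIn.last_exit`, `mem_uL_iff`, `mem_coe_uSites`.
-/

noncomputable section

open Set

namespace Literature.Probability.Percolation

open LatticeModels

/-! ### Inner monotonicity of the arm event -/

/-- **An arm from the inner arc of `U_{k,N}` contains an arm from the inner arc of `U_{s,N}`**
(`k + 1 ≤ s`, `s + 1 ≤ N`): follow the arm from its last visit to the inner half-box of scale
`s`. [folklore] -/
theorem armEv_mono_inner {k s N : ℕ} (hk : 1 ≤ k) (hks : k + 1 ≤ s) (hsN : s + 1 ≤ N) :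
    armEv k N ⊆ armEv s N := by
  rintro ω ⟨a, ha, b, hb, hp⟩
  have hk' : (1 : ℤ) ≤ k := by exact_mod_cast hk
  have hks' : (k : ℤ) + 1 ≤ s := by exact_mod_cast hks
  have hsN' : (s : ℤ) + 1 ≤ N := by exact_mod_cast hsN
  have hkN : k + 1 ≤ N := by omega
  have haL := (mem_uL_iff hk hkN).1 ha
  obtain ⟨hbU, hb'⟩ := hb
  have hbU' := (mem_coe_uSites.1 hbU).1
  have haI : a ∈ uInner s := by rw [mem_uInner]; omega
  have hbI : b ∉ uInner s := by intro h; rw [mem_uInner] at h; omega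
  obtain ⟨a', c, ha'I, -, hcI, ha'c, hq⟩ := hp.last_exit haI hbI
  rw [mem_uInner] at ha'I
  have h0 := triGraph_adj_coord ha'c 0
  have h1 := triGraph_adj_coord ha'c 1
  have hcU : c ∈ (↑(uSites k N) : Set (Site 2)) := hq.left_mem.1.1
  have hcU' := (mem_coe_uSites.1 hcU).1
  have hsub : ((↑(uSites k N) : Set (Site 2)) ∩ ω) \ uInner s ⊆ (↑(uSites s N) : Set (Site 2)) ∩ ω := by
    rintro z ⟨⟨hzU, hzω⟩, hzI⟩
    exact ⟨mem_coe_uSites.2 ⟨(mem_coe_uSites.1 hzU).1, hzI⟩, hzω⟩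
  refine ⟨c, ⟨mem_coe_uSites.2 ⟨hcU', hcI⟩, a', by rw [mem_uInner]; omega, ha'c⟩, b,
    ⟨mem_coe_uSites.2 ⟨hbU', hbI⟩, hb'⟩, hq.mono hsub⟩

/-- The arm event is determined by `U_{s,N}`. [folklore] -/
theorem determinedBy_armEv (s N : ℕ) : DeterminedBy (armEv s N) (↑(uSites s N) : Set (Site 2)) := by
  rw [determinedBy_iff]
  intro ω ω' h
  refine mem_armEv_congr fun v hv => ?_
  have := congrArg (fun S : Set (Site 2) => v ∈ S) h
  simp only [mem_inter_iff, hv, and_true, eq_iff_iff] at this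
  exact this

/-! ### The trimmed good event -/

section Gsc

variable (s : ℕ) (hs : 1 ≤ s)

/-- **The trimmed good event of the scale `s`**: fewer than `2T` stages; at every stage `u < 2T`
both tips protected at `K` scales from `M₀`, and the fence frames (`K'` scales from `M₁`, inner
half-box unforced) at the stages carrying a canonical crossing. [cite: Nolin2008, §4.4, proof of Lemma 15 (arXiv 0711.4948: Lemma 14)] -/
def Gsc (T K M₀ K' M₁ : ℕ) : Set (Set (Site 2)) :=
  {ω | (uQ s hs).numStages ω < 2 * T ∧ ∀ u < 2 * T,
      (uQ s hs).ProtO K M₀ ω u ∧ (uQ s hs).ProtO K M₀ ωᶜ u ∧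
      ((uQ s hs).HasCanon ((uQ s hs).canonSet ω u) → (uQ s hs).ProtOE (uInner s) K' M₁ ω u) ∧
      ((uQ s hs).HasCanon ((uQ s hs).canonSet ωᶜ u) → (uQ s hs).ProtOE (uInner s) K' M₁ ωᶜ u)}

variable {s hs}

/-- The good event is contained in the trimmed one. [folklore] -/
theorem good_subset_gsc (T K M₀ K' M₁ : ℕ) :
    {ω | (uQ s hs).Good T K M₀ K' M₁ (uInner s) ω} ⊆ Gsc s hs T K M₀ K' M₁ := by
  rintro ω ⟨hT, h⟩
  exact ⟨hT, fun u hu => ⟨(h u hu).1, (h u hu).2.1, fun _ => (h u hu).2.2.1, fun _ => (h u hu).2.2.2⟩⟩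

/-- **The two arms and the trimmed good event imply the frame event.** [cite: Nolin2008, §4.4, proof of Lemma 15 (arXiv 0711.4948: Lemma 14)] -/
theorem armEv_inter_gsc_subset {N : ℕ} (hN : 2 * s ≤ N) (T K M₀ K' M₁ : ℕ) :
    (armEv s N ∩ compl ⁻¹' armEv s N) ∩ Gsc s hs T K M₀ K' M₁ ⊆
      Zev s N hs T K M₀ ∩ {ω | ω ∈ Aev s N hs K' M₁ ω} := by
  rintro ω ⟨⟨harm, harmc⟩, hT, hall⟩
  rw [mem_preimage] at harmc
  obtain ⟨hselo, huo⟩ := sel_selStage (hs := hs) hN harm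
  obtain ⟨hselc, huc⟩ := sel_selStage (hs := hs) hN harmc
  rw [TriQuad.numStages_compl] at huc
  have hcano : (uQ s hs).HasCanon ((uQ s hs).canonSet ω (selStage s N hs ω)) := by
    obtain ⟨x, hx, y, hy, hp⟩ := TriQuad.exists_crossing_canonSet hselo.1
    exact TriQuad.hasCanon_of_pathIn hx hy hp
  have hcanc : (uQ s hs).HasCanon ((uQ s hs).canonSet ωᶜ (selStage s N hs ωᶜ)) := by
    obtain ⟨x, hx, y, hy, hp⟩ := TriQuad.exists_crossing_canonSet hselc.1
    exact TriQuad.hasCanon_of_pathIn hx hy hp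
  refine mem_zev_aev harm harmc hT (fun u hu => ⟨(hall u hu).1, (hall u hu).2.1⟩)
    ((hall _ (by omega)).2.2.1 hcano) ?_
  exact (hall _ (by omega)).2.2.2 hcanc

/-! ### Locality: the shell of the scale -/

/-- **The shell of the scale `s`** with reach `A`: the quad `U_{s,2s}` and the sites of the inner
half-box within `A` of the inner arc. [cite: Nolin2008, §4.3 Lemma 12 (arXiv 0711.4948: Lemma 11)] -/
def shell (s A : ℕ) : Set (Site 2) :=
  (↑(uSites s (2 * s)) : Set (Site 2)) ∪
    (uInner s ∩ {z | z 0 ≤ -(s : ℤ) + A ∨ (s : ℤ) - A ≤ z 0 ∨ (s : ℤ) - A ≤ z 1})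

/-- **The fence-frame event at a genuine stage only depends on the shell** (`A ≥ 2 · 3^{K'-1} M₁`). [cite: Nolin2008, §4.3 Lemma 12 (arXiv 0711.4948: Lemma 11)] -/
theorem protOE_congr_shell {K' M₁ A : ℕ} (hA : 2 * 3 ^ (K' - 1) * M₁ ≤ A) {ω ω' : Set (Site 2)}
    (h : ∀ v ∈ shell s A, v ∈ ω ↔ v ∈ ω') {u : ℕ} (hcan : (uQ s hs).HasCanon ((uQ s hs).canonSet ω u)) :
    (uQ s hs).ProtOE (uInner s) K' M₁ ω u ↔ (uQ s hs).ProtOE (uInner s) K' M₁ ω' u := by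
  have hs' : (1 : ℤ) ≤ s := by exact_mod_cast hs
  have hU : ∀ v ∈ (uQ s hs).U, v ∈ ω ↔ v ∈ ω' := fun v hv => h v (Or.inl (Finset.mem_coe.2 hv))
  obtain ⟨hlL, -⟩ := TriQuad.canonSupport_spec hcan
  have hlL' : (uQ s hs).canonStart ((uQ s hs).canonSet ω u) ∈ uL s (2 * s) := hlL
  have hl := (mem_uL_iff hs (by omega)).1 hlL'
  unfold TriQuad.ProtOE
  rw [TriQuad.openStop_congr hU u, TriQuad.canonSet_congr hU u]
  refine exists_congr fun i => and_congr_right fun hi => ?_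
  set l := (uQ s hs).canonStart ((uQ s hs).canonSet ω u)
  set D : Set (Site 2) := ↑((uQ s hs).openStop ω u) ∪ ((↑(uQ s hs).U : Set (Site 2)) ∪ uInner s)ᶜ
  have hM : 2 * ((3 ^ i * M₁ : ℕ) : ℤ) ≤ A := by
    have h3' : 3 ^ i ≤ 3 ^ (K' - 1) := Nat.pow_le_pow_right (by norm_num) (by omega)
    have : 2 * (3 ^ i * M₁) ≤ A := le_trans (by nlinarith) hA
    exact_mod_cast this
  unfold triForcedFrame
  simp only [mem_setOf_eq]
  apply (determinedBy_iff _ _).1 (determinedBy_triFrameAt l (3 ^ i * M₁))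
  have key : ∀ v, v ∈ (↑(triSqAnnulusFinset l (3 ^ i * M₁) (2 * (3 ^ i * M₁))) : Set (Site 2)) → v ∉ D →
      v ∈ shell s A := by
    intro v hann hvD
    have hb := (mem_triSqAnnulusFinset.1 (Finset.mem_coe.1 hann)).1
    by_cases hvU : v ∈ (↑(uSites s (2 * s)) : Set (Site 2))
    · exact Or.inl hvU
    · have hvI : v ∈ uInner s := by
        by_contra hvI
        exact hvD (Or.inr fun hv' => hv'.elim hvU hvI)
      refine Or.inr ⟨hvI, ?_⟩
      rw [mem_uInner] at hvI
      show v 0 ≤ -(s : ℤ) + A ∨ (s : ℤ) - A ≤ v 0 ∨ (s : ℤ) - A ≤ v 1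
      rcases hl with ⟨hl0, -, -⟩ | ⟨hl1, -, -⟩ | ⟨hl0, -, -⟩ <;> omega
  ext v
  simp only [mem_inter_iff, mem_union]
  constructor
  · rintro ⟨hv, hann⟩
    refine ⟨?_, hann⟩
    by_cases hvD : v ∈ D
    · exact Or.inr hvD
    · rcases hv with hvω | hvD'
      · exact Or.inl ((h v (key v hann hvD)).1 hvω)
      · exact absurd hvD' hvD
  · rintro ⟨hv, hann⟩
    refine ⟨?_, hann⟩
    by_cases hvD : v ∈ D
    · exact Or.inr hvD
    · rcases hv with hvω | hvD'
      · exact Or.inl ((h v (key v hann hvD)).2 hvω)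
      · exact absurd hvD' hvD

/-- **The trimmed good event only depends on the shell.** [cite: Nolin2008, §4.3 Lemma 12 (arXiv 0711.4948: Lemma 11)] -/
theorem gsc_congr_shell {T K M₀ K' M₁ A : ℕ} (hA : 2 * 3 ^ (K' - 1) * M₁ ≤ A) {ω ω' : Set (Site 2)}
    (h : ∀ v ∈ shell s A, v ∈ ω ↔ v ∈ ω') :
    ω ∈ Gsc s hs T K M₀ K' M₁ ↔ ω' ∈ Gsc s hs T K M₀ K' M₁ := by
  have hU : ∀ v ∈ (uQ s hs).U, v ∈ ω ↔ v ∈ ω' := fun v hv => h v (Or.inl (Finset.mem_coe.2 hv))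
  have hc : ∀ v ∈ shell s A, v ∈ ωᶜ ↔ v ∈ ω'ᶜ := fun v hv => not_congr (h v hv)
  have hUc := TriQuad.compl_agree hU
  simp only [Gsc, mem_setOf_eq, TriQuad.numStages_congr hU]
  refine and_congr_right fun _ => forall_congr' fun u => imp_congr_right fun _ => ?_
  rw [TriQuad.protO_congr hU, TriQuad.protO_congr hUc]
  refine and_congr_right fun _ => and_congr_right fun _ => and_congr ?_ ?_
  · rw [TriQuad.canonSet_congr hU u]
    exact imp_congr_right fun hcan => protOE_congr_shell hA h hcan
  · rw [TriQuad.canonSet_congr hUc u]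
    exact imp_congr_right fun hcan => protOE_congr_shell hA hc hcan

/-- **The trimmed good event is determined by the shell.** [cite: Nolin2008, §4.3 Lemma 12 (arXiv 0711.4948: Lemma 11)] -/
theorem determinedBy_gsc {T K M₀ K' M₁ A : ℕ} (hA : 2 * 3 ^ (K' - 1) * M₁ ≤ A) :
    DeterminedBy (Gsc s hs T K M₀ K' M₁) (shell s A) := by
  rw [determinedBy_iff]
  intro ω ω' hω
  refine gsc_congr_shell hA fun v hv => ?_
  have := congrArg (fun S : Set (Site 2) => v ∈ S) hω
  simp only [mem_inter_iff, hv, and_true, eq_iff_iff] at this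
  exact this

end Gsc

end Literature.Probability.Percolation
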